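import Mathlib
import Summits.MatrixMultiplication.MatrixMultiplication.Theorems.SoloBlindEulerFrame

/-!
# SoloBlindEulerDiagonal — the diagonal of the Hadamard multiplier is invisible (paper §17.15 (F)(5)/(F)(6))

solo `solo-MatrixMultiplication-blind`; evidence file
`run/shared/lean/ideation/MatrixMultiplication/solo-blind/paper/paper.md`, §17.15 (F)(5)–(F)(6); continues
`SoloBlindEulerFrame` (same notation: `soloEulerLin a c = a + c z` on `B = R[z]/(z³ − 1)`, `soloEulerD = diag(0,1,−1)`,
`soloEulerK4 c m t b = det (rows ≠ t of [c | m | e_b])`, `soloEulerSgn t = (−1)^t`).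

In the decimation proof of Theorem 17.15 the compressed site operator at an Euler stage is the block-Hadamard product
`Ω ⊛ (U σ Wᵀ)`, and its `(s,s)` blocks are `σ_ss` (`s < 4`) and `Σ_{t,b} (−1)^t σ_tb` (`s = 4`), where
`σ_tb = Φ_t · K4[t,b] · D · (a_b + c_b z)` and `Φ_t = ρ⁻¹ (a_t + c_t z)`.  This file proves that both vanish
identically, so the diagonal entries of the multiplier `Ω` never enter:
* `soloEuler_K4_diag` : `K4 t t = 0` (the column `e_t` is deleted with row `t`);
* `soloEuler_altA_mul_a`, `soloEuler_altA_mul_c` : with `A_b := Σ_t (−1)^t a_t K4 t b` (`= ± det[c | m | e_b | a]`),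
  `Σ_b A_b a_b = 0` and `Σ_b A_b c_b = 0` (the determinants `det[c|m|a|a]`, `det[c|m|c|a]` vanish);
* `soloEuler_mixed_block` : `Σ_t Σ_b (−1)^t K4 t b · (a_t + c_t z) D (a_b + c_b z) = 0` as a `3 × 3` matrix —
  the numerator of `ρ · Σ_{t,b} (−1)^t σ_tb`; informally: `Σ_t (−1)^t (a_t + c_t z) K4[t,b] = A_b + z · 0`
  by `soloEuler_alt_c_K4`, and then `Σ_b A_b D (a_b + c_b z) = D (Σ_b A_b a_b + z Σ_b A_b c_b) = 0`.
* `soloEuler_K4_sgn_skew` : `(−1)^t K4 t b + (−1)^b K4 b t = 0` — `K4 = D_sgn S` with `S` the SKEW matrix of the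
  2-form `⋆(c ∧ m)`; and its corollary `soloEuler_altA_eq` : `A_s = −(−1)^s (K4 a)_s`.

INFORMAL CONTEXT for the last two (evidence file, §17.15 (F)(6), THEOREM S): for `p = 2` and every multiplier `Ω` that is
SYMMETRIC off the diagonal, the single-site step `S1(Ω; θ)` has, besides the five Euler products, the kernel vectors
`e_4 ⊗ z + Σ_r x_r e_r ⊗ 1` and `e_4 ⊗ z² + Σ_r y_r e_r ⊗ z²`; the solvability condition of the linear systems for
`x`, `y` is `wᵀ Q w = 0` (`w_s = Ω_{s4}`) with `Q = D_A (Ω ∘ K4)⁻¹ D_{K4 a}`, and `Q` is skew exactly because of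
`soloEuler_K4_sgn_skew` / `soloEuler_altA_eq` and the symmetry of `Ω`.  Hence `rank S1 ≤ 8 < 10` for symmetric
multipliers — every dressed multiplier is symmetric — which is why single-site decimation chains never close
(centre dimensions 5, 7, 5, 7, …) and the proof of Theorem 17.15 decimates in PAIRS.  That consequence is not
formalised here.  All statements below are polynomial identities over an arbitrary commutative ring, proved by
computation.  Standard axioms.
-/

namespace Summit.MatrixMultiplication.MatrixMultiplication.Theorems

open Matrix

section

variable {R : Type*} [CommRing R]

/-- `K4 t t = 0`: deleting row `t` from `[c | m | e_t]` leaves a zero third column. -/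
theorem soloEuler_K4_diag (c m : Fin 4 → R) (t : Fin 4) : soloEulerK4 c m t t = 0 := by
  fin_cases t <;> simp [soloEulerK4, soloEulerRows, Matrix.det_fin_three]

/-- The coefficient `A_b = Σ_t (−1)^t a_t K4 t b` (`± det [c | m | e_b | a]`). -/
def soloEulerAltA (a c m : Fin 4 → R) (b : Fin 4) : R :=
  ∑ t : Fin 4, soloEulerSgn t * a t * soloEulerK4 c m t b

/-- `Σ_b A_b a_b = 0` (`det [c | m | a | a] = 0`). -/
theorem soloEuler_altA_mul_a (a c m : Fin 4 → R) : ∑ b : Fin 4, soloEulerAltA a c m b * a b = 0 := by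
  simp [soloEulerAltA, soloEulerK4, soloEulerRows, soloEulerSgn, Fin.sum_univ_four, Matrix.det_fin_three]
  ring

/-- `Σ_b A_b c_b = 0` (`det [c | m | c | a] = 0`). -/
theorem soloEuler_altA_mul_c (a c m : Fin 4 → R) : ∑ b : Fin 4, soloEulerAltA a c m b * c b = 0 := by
  simp [soloEulerAltA, soloEulerK4, soloEulerRows, soloEulerSgn, Fin.sum_univ_four, Matrix.det_fin_three]
  ring

/-- Sign-twisted skewness of `K4`: `(−1)^t K4 t b + (−1)^b K4 b t = 0` (`K4 = D_sgn S`, `S_{tb}` = the coefficient of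
`e_0 ∧ e_1 ∧ e_2 ∧ e_3` in `c ∧ m ∧ e_b ∧ e_t`, a skew matrix). -/
theorem soloEuler_K4_sgn_skew (c m : Fin 4 → R) (t b : Fin 4) :
    soloEulerSgn t * soloEulerK4 c m t b + soloEulerSgn b * soloEulerK4 c m b t = 0 := by
  fin_cases t <;> fin_cases b <;>
    simp [soloEulerK4, soloEulerRows, soloEulerSgn, Matrix.det_fin_three]

/-- `A_s = −(−1)^s (K4 a)_s`: the alternating `a`-contraction of the columns of `K4` is the sign-twisted row action. -/
theorem soloEuler_altA_eq (a c m : Fin 4 → R) (s : Fin 4) :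
    soloEulerAltA a c m s = -(soloEulerSgn s * (soloEulerK4 c m *ᵥ a) s) := by
  fin_cases s <;>
    simp [soloEulerAltA, soloEulerK4, soloEulerRows, soloEulerSgn, Fin.sum_univ_four, Matrix.mulVec, dotProduct,
      Matrix.det_fin_three] <;> ring

/-- THE MIXED BLOCK IDENTITY: `Σ_t Σ_b (−1)^t K4 t b · (a_t + c_t z) D (a_b + c_b z) = 0` (a `3 × 3` matrix over `R`).
This is `ρ · Σ_{t,b} (−1)^t σ_tb` for the twisted site operator `σ_tb = ρ⁻¹ (a_t + c_t z) K4[t,b] D (a_b + c_b z)`,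
so the `(4,4)` block of `U σ Wᵀ` vanishes and the diagonal entry `Ω_44` of the multiplier never enters; the other
diagonal entries drop out by `soloEuler_K4_diag`. -/
theorem soloEuler_mixed_block (a c m : Fin 4 → R) :
    ∑ t : Fin 4, ∑ b : Fin 4,
      (soloEulerSgn t * soloEulerK4 c m t b) •
        (soloEulerLin (a t) (c t) * soloEulerD * soloEulerLin (a b) (c b)) = (0 : Matrix (Fin 3) (Fin 3) R) := by
  ext i j
  simp only [Matrix.sum_apply, Matrix.smul_apply, Matrix.zero_apply, smul_eq_mul]
  fin_cases i <;> fin_cases j <;>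
    simp [soloEulerLin, soloEulerCyc, soloEulerD, soloEulerK4, soloEulerRows, soloEulerSgn, Fin.sum_univ_four,
      Fin.sum_univ_three, Matrix.mul_apply, Matrix.one_apply, Matrix.diagonal, Matrix.det_fin_three] <;>
    ring

end

end Summit.MatrixMultiplication.MatrixMultiplication.Theorems
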